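import Summits.BirchSwinnertonDyer.BirchSwinnertonDyer.Theorems.KolyvaginRankRigidityAtTwoWalkStepGood
import Summits.BirchSwinnertonDyer.BirchSwinnertonDyer.Theorems.KolyvaginRankRigidityAtTwoWalkStepPure
import HarnessLib

/-!
# Crux U1 `KolyvaginBoundedDefectAtTwo` (stmt-BirchSwinnertonDyer-28083), LINE 17 `regular_core_rigidity`,
# stub S1b `stub_nearCoreExistenceAtTwo` — THE WALK, part 3: the induction on rounds

Width seat `bsd-line-krr2-p2` g15 (ONE READER on S1b); `--supports stmt-BirchSwinnertonDyer-28083` (helper).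
THEOREMS ONLY; nothing here proves S1b, U1, a rung or BSD. BSD is NOT proved.

Frame conventions as in `…WalkStepGood`. The SCHEDULE: with `P` (`N`) the number of alive non-`x₀` classes of sign
`+1` (`−1`), a ROUND removes two of them — one good step if `P, N ≥ 1`, else a pure step followed by a good step —
using `1` resp. `2` regular primes; after `(P+N)/2` rounds only `x₀` is alive, `max P N` primes were used, and the
(F3) exponent is bounded by a function of the number of rounds and the initial exponents ONLY (not of the level
`2^k`): `walk_rounds` (`∀ t J d, ∃ J', ∀ k …`). The terminal vertex is then a sign-free NEAR-CORE vertex of error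
`J' + 1` (`nearCore_of_aliveSingleton`: (F3) with `A = {i₀}` plus Sah at `2`). [cite: MazurRubin2004, §4.1, Prop. 4.1.5,
Cor. 2.7.3] [cite: Jetchev2008, Prop. 5.3] [cite: GrossLMS1991, §9 Prop. 9.1]
Design: no definitions; `K : Type`; axioms `propext`, `Classical.choice`, `Quot.sound`.
-/

set_option autoImplicit false
-- the Theorems namespace of this sub repeats the summit name by design (D-0017 nested layout)
set_option linter.dupNamespace false

noncomputable section

open scoped Classical
open Function NumberField IsDedekindDomain WeierstrassCurve Field Finset
open Literature.NumberTheory.EllipticCurves Literature.NumberTheory.EllipticCurves.Jetchev2008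
open Literature.NumberTheory.EllipticCurves.KolyvaginPairing
open Literature.NumberTheory.GaloisRepresentations Literature.NumberTheory.GaloisCohomology
open Literature.NumberTheory.GaloisRepresentations.DiscreteGaloisModule (transverseSubgroup SelmerStructure)
open Literature.NumberTheory.Automorphic
open Summit.BirchSwinnertonDyer.Rank1Residual
open Summit.BirchSwinnertonDyer.Rank1Residual.JET.SelmerVocabulary
open Summit.BirchSwinnertonDyer.BirchSwinnertonDyer.Theorems.KolyvaginLowerBoundAtTwo (torsionFixing_le_of_dvd)

namespace Summit.BirchSwinnertonDyer.BirchSwinnertonDyer.Theorems.KolyvaginAtTwo.RegularWalk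

variable {K : Type} [Field K] [NumberField K] (W : WeierstrassCurve ℚ) [W.IsElliptic] [W.IsGloballyMinimal]

/-! ### §1 Monotonicity of the frame exponents; Finset bookkeeping -/

omit [W.IsElliptic] [W.IsGloballyMinimal] in
/-- (F3) is monotone in its exponent. [folklore] -/
theorem frameF3_mono (k : ℕ) {m : ℕ} (g : Fin m → galH1Torsion (W.baseChange K) ((2 ^ k : ℕ) : ℤ)) (A : Finset (Fin m))
    {J J₂ : ℕ} (hJ : J ≤ J₂) {u : galH1Torsion (W.baseChange K) ((2 ^ k : ℕ) : ℤ)}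
    (h : ∃ b : Fin m → ℤ, ∀ ρ ∈ torsionFixing (W.baseChange K) ((2 ^ (k + 1) : ℕ) : ℤ),
      h1Eval (W.baseChange K) ((2 ^ k : ℕ) : ℤ) (((2 : ℤ) ^ J) • u - ∑ i ∈ A, b i • g i) ρ = 0) :
    ∃ b : Fin m → ℤ, ∀ ρ ∈ torsionFixing (W.baseChange K) ((2 ^ (k + 1) : ℕ) : ℤ),
      h1Eval (W.baseChange K) ((2 ^ k : ℕ) : ℤ) (((2 : ℤ) ^ J₂) • u - ∑ i ∈ A, b i • g i) ρ = 0 := by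
  obtain ⟨b, hb⟩ := h
  refine ⟨fun i ↦ (2 : ℤ) ^ (J₂ - J) * b i, fun ρ hρ ↦ ?_⟩
  have e : ((2 : ℤ) ^ J₂) • u - ∑ i ∈ A, ((2 : ℤ) ^ (J₂ - J) * b i) • g i =
      ((2 : ℤ) ^ (J₂ - J)) • (((2 : ℤ) ^ J) • u - ∑ i ∈ A, b i • g i) := by
    rw [zsmul_sub, zsmul_zsmul_eq_mul_zsmul, ← pow_add, Nat.sub_add_cancel hJ, zsmul_finset_sum]
    simp_rw [zsmul_zsmul_eq_mul_zsmul]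
  rw [e, res_zsmul W k _ _ hρ, hb ρ hρ, smul_zero]

/-- (F4) is monotone in its exponent. [folklore] -/
theorem frameF4_mono {m : ℕ} {A : Finset (Fin m)} {k d d₂ : ℕ} (hd : d ≤ d₂) {Q : (Fin m → ℤ) → Prop}
    (h : ∀ b : Fin m → ℤ, Q b → ∀ i ∈ A, (2 : ℤ) ^ (k - d) ∣ b i) :
    ∀ b : Fin m → ℤ, Q b → ∀ i ∈ A, (2 : ℤ) ^ (k - d₂) ∣ b i :=
  fun b hb i hi ↦ (pow_dvd_pow 2 (by omega)).trans (h b hb i hi)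

/-- Removing two alive indices: the count of the remaining non-`x₀` classes of a given sign. [folklore] -/
theorem card_filter_erase_erase {m : ℕ} (A : Finset (Fin m)) (p : Fin m → Prop) [DecidablePred p] {i₀ i₁ i₂ : Fin m}
    (h₁ : i₁ ≠ i₀) (h₂ : i₂ ≠ i₀) (h₁₂ : i₁ ≠ i₂) (hi₁ : i₁ ∈ A) (hi₂ : i₂ ∈ A) :
    ((((A.erase i₁).erase i₂).erase i₀).filter p).card + (if p i₁ then 1 else 0) + (if p i₂ then 1 else 0) =
      ((A.erase i₀).filter p).card := by
  have e : ((A.erase i₁).erase i₂).erase i₀ = ((A.erase i₀).erase i₁).erase i₂ := by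
    rw [Finset.erase_right_comm (a := i₂), Finset.erase_right_comm (a := i₁)]
  rw [e, Finset.filter_erase, Finset.filter_erase]
  set F := (A.erase i₀).filter p with hF
  have hi₁' : i₁ ∈ A.erase i₀ := Finset.mem_erase.mpr ⟨h₁, hi₁⟩
  have hi₂' : i₂ ∈ A.erase i₀ := Finset.mem_erase.mpr ⟨h₂, hi₂⟩
  by_cases hp₁ : p i₁ <;> by_cases hp₂ : p i₂ <;> simp only [hp₁, hp₂, if_true, if_false, add_zero]
  · have hm₁ : i₁ ∈ F := Finset.mem_filter.mpr ⟨hi₁', hp₁⟩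
    have hm₂ : i₂ ∈ F.erase i₁ := Finset.mem_erase.mpr ⟨h₁₂.symm, Finset.mem_filter.mpr ⟨hi₂', hp₂⟩⟩
    have h2 : 1 < F.card := Finset.one_lt_card.mpr ⟨i₁, hm₁, i₂, Finset.mem_filter.mpr ⟨hi₂', hp₂⟩, h₁₂⟩
    rw [Finset.card_erase_of_mem hm₂, Finset.card_erase_of_mem hm₁]
    omega
  · have hm₁ : i₁ ∈ F := Finset.mem_filter.mpr ⟨hi₁', hp₁⟩
    have h1 : 0 < F.card := Finset.card_pos.mpr ⟨i₁, hm₁⟩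
    rw [Finset.erase_eq_of_notMem (fun h ↦ hp₂ (Finset.mem_filter.mp (Finset.mem_of_mem_erase h)).2),
      Finset.card_erase_of_mem hm₁]
    omega
  · have hm₂ : i₂ ∈ F := Finset.mem_filter.mpr ⟨hi₂', hp₂⟩
    have h1 : 0 < F.card := Finset.card_pos.mpr ⟨i₂, hm₂⟩
    rw [Finset.erase_eq_of_notMem (s := F) (fun h ↦ hp₁ (Finset.mem_filter.mp h).2), Finset.card_erase_of_mem hm₂]
    omega
  · rw [Finset.erase_eq_of_notMem (s := F) (fun h ↦ hp₁ (Finset.mem_filter.mp h).2),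
      Finset.erase_eq_of_notMem (fun h ↦ hp₂ (Finset.mem_filter.mp h).2)]

/-- Prime factors of `c ℓ` for a fresh prime `ℓ`: one more. [folklore] -/
theorem card_primeFactors_mul_of_not_dvd {c ℓ : ℕ} (hc : c ≠ 0) (hℓ : ℓ.Prime) (hℓc : ¬ ℓ ∣ c) :
    (c * ℓ).primeFactors.card = c.primeFactors.card + 1 := by
  rw [Nat.primeFactors_mul hc hℓ.ne_zero, hℓ.primeFactors, Finset.union_comm, ← Finset.insert_eq,
    Finset.card_insert_of_notMem (fun h ↦ hℓc (Nat.dvd_of_mem_primeFactors h))]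

/-! ### §2 A pure step followed by a good step (the round used when all non-`x₀` alive classes have one sign) -/

set_option maxHeartbeats 400000 in
/-- **PURE-THEN-GOOD ROUND.** Two alive non-`x₀` indices `i₁ ≠ i₂` of the SAME sign: a pure step cutting `g_{i₁}`
(new class `q'` of the opposite sign at index `i₁`) followed by a good step cutting `g_{i₂}` and `q'`. Net effect: two
regular primes adjoined, alive set `A ∖ {i₁, i₂}`, frame `g` unchanged on it, exponents
`(J, d) ↦ (5J + 18d + 17, 8d + 2J + 7)`. [cite: MazurRubin2004, §4.1, Prop. 4.1.5] [cite: Jetchev2008, Prop. 5.3] -/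
theorem round_pure_good (k : ℕ) (hk : 1 ≤ k)
    (e : geomTorsion (W.baseChange K) ((2 ^ k : ℕ) : ℤ) → geomTorsion (W.baseChange K) ((2 ^ k : ℕ) : ℤ) →
      AlgebraicClosure K)
    (hμ : ∀ S T, e S T ^ (2 ^ k) = 1)
    (hadd₁ : ∀ S₁ S₂ T, e (S₁ + S₂) T = e S₁ T * e S₂ T)
    (hadd₂ : ∀ S T₁ T₂, e S (T₁ + T₂) = e S T₁ * e S T₂)
    (hgal : ∀ (γ : absoluteGaloisGroup K) (S T : geomTorsion (W.baseChange K) ((2 ^ k : ℕ) : ℤ)),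
      γ • e S T = e (γ • S) (γ • T))
    (halt : ∀ T, e T T = 1) (hnondeg : ∀ T, (∀ S, e S T = 1) → T = 0)
    (inv : LocalInvariants K (2 ^ k)) (hperf : inv.IsPerfect) (hvan : inv.SumLocalTermEqZero)
    (hcomp : inv.SelmerComplement)
    (hK : IsImaginaryQuadratic K) (hD : NumberField.discr K < -4) (hodd : Odd (NumberField.discr K))
    (ι : K →+* ℂ) [∀ j : ℕ, NumberField (ringClassField K ι j)] [NeZero (W.conductorNorm ℤ)]
    (hH : SatisfiesHeegnerHypothesis (W.conductorNorm ℤ) K)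
    (hρ2 : W.HasSurjectiveModNGaloisRep 2) (hsurj : W.HasSurjectiveModNGaloisRep ((2 ^ (k + 1) : ℕ) : ℤ))
    {τ : K ≃ₐ[ℚ] K} (hτ1 : τ ≠ 1)
    (hτe : ∀ S T, liftAut τ (e S T) =
      e ((isLiftOfAut_liftAut τ).torsionMap W ((2 ^ k : ℕ) : ℤ) S) ((isLiftOfAut_liftAut τ).torsionMap W ((2 ^ k : ℕ) : ℤ) T))
    (hinvc : inv.IsConjCompatible τ) (bnd : ℕ)
    {c : ℕ} (hc : Squarefree c)
    (hprimes : ∀ ℓ ∈ c.primeFactors, Zhang2014.IsKolyvaginPrime (W.conductorNorm ℤ) W K 2 ℓ ∧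
      k + 1 ≤ Zhang2014.kolyvaginIndex W 2 ℓ ∧ bnd < ℓ ∧ (∃ (v₁ : HeightOneSpectrum (𝓞 ℚ)) (𝔓₁ : Ideal (absIntegers (𝓞 ℚ) ℚ)) (h : absoluteGaloisGroup ℚ),
          (ℓ : 𝓞 ℚ) ∈ v₁.asIdeal ∧ 𝔓₁ ∈ v₁.primesAbove ∧ IsArithFrobAt (𝓞 ℚ) h 𝔓₁ ∧
          (∀ X : geomTorsion W ((2 ^ k : ℕ) : ℤ), h • h • X = X) ∧
          ∃ P : geomTorsion W ((2 ^ k : ℕ) : ℤ), (2 : ℤ) ^ (k - 1) • (P + h • P) ≠ 0))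
    {m : ℕ} (g : Fin m → galH1Torsion (W.baseChange K) ((2 ^ k : ℕ) : ℤ))
    (sg : Fin m → ℤ) (A : Finset (Fin m))
    (hgS : ∀ i ∈ A, g i ∈ modifiedSelmerGroup W K ι ((2 ^ k : ℕ) : ℤ) c)
    (hsg : ∀ i, sg i = 1 ∨ sg i = -1)
    (hgτ : ∀ i, conjAct W τ ((2 ^ k : ℕ) : ℤ) (g i) = sg i • g i)
    {J d : ℕ}
    (hF3 : ∀ u : galH1Torsion (W.baseChange K) ((2 ^ k : ℕ) : ℤ), u ∈ modifiedSelmerGroup W K ι ((2 ^ k : ℕ) : ℤ) c →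
      ∃ b : Fin m → ℤ, ∀ ρ ∈ torsionFixing (W.baseChange K) ((2 ^ (k + 1) : ℕ) : ℤ),
        h1Eval (W.baseChange K) ((2 ^ k : ℕ) : ℤ) (((2 : ℤ) ^ J) • u - ∑ i ∈ A, b i • g i) ρ = 0)
    (hF4 : ∀ b : Fin m → ℤ, (∀ ρ ∈ torsionFixing (W.baseChange K) ((2 ^ (k + 1) : ℕ) : ℤ),
        h1Eval (W.baseChange K) ((2 ^ k : ℕ) : ℤ) (∑ i ∈ A, b i • g i) ρ = 0) → ∀ i ∈ A, (2 : ℤ) ^ (k - d) ∣ b i)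
    {i₁ i₂ : Fin m} (hi₁ : i₁ ∈ A) (hi₂ : i₂ ∈ A) (hne : i₁ ≠ i₂) (hss : sg i₁ = sg i₂) :
    ∃ c' : ℕ, Squarefree c' ∧ c'.primeFactors.card = c.primeFactors.card + 2 ∧
      (∀ ℓ ∈ c'.primeFactors, Zhang2014.IsKolyvaginPrime (W.conductorNorm ℤ) W K 2 ℓ ∧
        k + 1 ≤ Zhang2014.kolyvaginIndex W 2 ℓ ∧ bnd < ℓ ∧ (∃ (v₁ : HeightOneSpectrum (𝓞 ℚ)) (𝔓₁ : Ideal (absIntegers (𝓞 ℚ) ℚ)) (h : absoluteGaloisGroup ℚ),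
          (ℓ : 𝓞 ℚ) ∈ v₁.asIdeal ∧ 𝔓₁ ∈ v₁.primesAbove ∧ IsArithFrobAt (𝓞 ℚ) h 𝔓₁ ∧
          (∀ X : geomTorsion W ((2 ^ k : ℕ) : ℤ), h • h • X = X) ∧
          ∃ P : geomTorsion W ((2 ^ k : ℕ) : ℤ), (2 : ℤ) ^ (k - 1) • (P + h • P) ≠ 0)) ∧
      (∀ i ∈ (A.erase i₁).erase i₂, g i ∈ modifiedSelmerGroup W K ι ((2 ^ k : ℕ) : ℤ) c') ∧
      (∀ u : galH1Torsion (W.baseChange K) ((2 ^ k : ℕ) : ℤ),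
        u ∈ modifiedSelmerGroup W K ι ((2 ^ k : ℕ) : ℤ) c' → ∃ b : Fin m → ℤ,
        ∀ ρ ∈ torsionFixing (W.baseChange K) ((2 ^ (k + 1) : ℕ) : ℤ),
          h1Eval (W.baseChange K) ((2 ^ k : ℕ) : ℤ)
            (((2 : ℤ) ^ (5 * J + 18 * d + 17)) • u - ∑ i ∈ (A.erase i₁).erase i₂, b i • g i) ρ = 0) ∧
      (∀ b : Fin m → ℤ, (∀ ρ ∈ torsionFixing (W.baseChange K) ((2 ^ (k + 1) : ℕ) : ℤ),
          h1Eval (W.baseChange K) ((2 ^ k : ℕ) : ℤ) (∑ i ∈ (A.erase i₁).erase i₂, b i • g i) ρ = 0) →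
        ∀ i ∈ (A.erase i₁).erase i₂, (2 : ℤ) ^ (k - (8 * d + 2 * J + 7)) ∣ b i) := by
  classical
  have hkol : ∀ ℓ ∈ c.primeFactors, Zhang2014.IsKolyvaginPrime (W.conductorNorm ℤ) W K 2 ℓ := fun ℓ h ↦ (hprimes ℓ h).1
  have hkM : ∀ ℓ ∈ c.primeFactors, k + 1 ≤ Zhang2014.kolyvaginIndex W 2 ℓ := fun ℓ h ↦ (hprimes ℓ h).2.1
  -- the pure step at `i₁`
  obtain ⟨ℓ₁, hbnd₁, hℓ₁c, hKol₁, hidx₁, hreg₁, q', hq'S, hq'τ, hsurv₁, hF3₁, hF4₁⟩ :=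
    walkStep_pure W k hk e hμ hadd₁ hadd₂ hgal halt hnondeg inv hperf hvan hcomp hK hD hodd ι hH hρ2 hsurj hτ1 hτe hinvc
      hc hkol hkM g sg A hgS hsg hgτ hF3 hF4 hi₁ bnd
  have hc0 : c ≠ 0 := hc.ne_zero
  have hcℓ₁ : Squarefree (c * ℓ₁) :=
    Nat.squarefree_mul_iff.mpr ⟨((Nat.Prime.coprime_iff_not_dvd hKol₁.1).mpr hℓ₁c).symm, hc, hKol₁.1.squarefree⟩
  have hpf₁ : (c * ℓ₁).primeFactors = insert ℓ₁ c.primeFactors := by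
    rw [Nat.primeFactors_mul hc0 hKol₁.1.ne_zero, hKol₁.1.primeFactors, Finset.union_comm, ← Finset.insert_eq]
  have hprimes₁ : ∀ ℓ ∈ (c * ℓ₁).primeFactors, Zhang2014.IsKolyvaginPrime (W.conductorNorm ℤ) W K 2 ℓ ∧
      k + 1 ≤ Zhang2014.kolyvaginIndex W 2 ℓ ∧ bnd < ℓ ∧
      ∃ (v₁ : HeightOneSpectrum (𝓞 ℚ)) (𝔓₁ : Ideal (absIntegers (𝓞 ℚ) ℚ)) (h : absoluteGaloisGroup ℚ),
        (ℓ : 𝓞 ℚ) ∈ v₁.asIdeal ∧ 𝔓₁ ∈ v₁.primesAbove ∧ IsArithFrobAt (𝓞 ℚ) h 𝔓₁ ∧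
        (∀ X : geomTorsion W ((2 ^ k : ℕ) : ℤ), h • h • X = X) ∧
        ∃ P : geomTorsion W ((2 ^ k : ℕ) : ℤ), (2 : ℤ) ^ (k - 1) • (P + h • P) ≠ 0 := by
    intro ℓ h
    rw [hpf₁, Finset.mem_insert] at h
    rcases h with rfl | h
    · exact ⟨hKol₁, hidx₁, hbnd₁, hreg₁⟩
    · exact hprimes ℓ h
  -- the new frame `g[i₁ ↦ q']`, signs `sg[i₁ ↦ -sg i₁]`
  set g₁ : Fin m → galH1Torsion (W.baseChange K) ((2 ^ k : ℕ) : ℤ) := Function.update g i₁ q' with hg₁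
  set sg₁ : Fin m → ℤ := Function.update sg i₁ (-sg i₁) with hsg₁
  have hg₁i₁ : g₁ i₁ = q' := by rw [hg₁, Function.update_self]
  have hg₁ne : ∀ i, i ≠ i₁ → g₁ i = g i := fun i hi ↦ by rw [hg₁, Function.update_of_ne hi]
  have hsg₁i₁ : sg₁ i₁ = -sg i₁ := by rw [hsg₁, Function.update_self]
  have hsg₁ne : ∀ i, i ≠ i₁ → sg₁ i = sg i := fun i hi ↦ by rw [hsg₁, Function.update_of_ne hi]
  have hgS₁ : ∀ i ∈ A, g₁ i ∈ modifiedSelmerGroup W K ι ((2 ^ k : ℕ) : ℤ) (c * ℓ₁) := by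
    intro i hi
    by_cases h : i = i₁
    · rw [h, hg₁i₁]; exact hq'S
    · rw [hg₁ne i h]; exact hsurv₁ i (Finset.mem_erase.mpr ⟨h, hi⟩)
  have hsg₁' : ∀ i, sg₁ i = 1 ∨ sg₁ i = -1 := by
    intro i
    by_cases h : i = i₁
    · rw [h, hsg₁i₁]; rcases hsg i₁ with h' | h' <;> simp [h']
    · rw [hsg₁ne i h]; exact hsg i
  have hgτ₁ : ∀ i, conjAct W τ ((2 ^ k : ℕ) : ℤ) (g₁ i) = sg₁ i • g₁ i := by
    intro i
    by_cases h : i = i₁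
    · rw [h, hg₁i₁, hsg₁i₁]; exact hq'τ
    · rw [hg₁ne i h, hsg₁ne i h]; exact hgτ i
  -- the indices of the good step: `i₊` of sign `+1`, `i₋` of sign `-1` (for `sg₁`)
  obtain ⟨ip, im, hip, him, hpm, hsp, hsm, hAeq⟩ : ∃ ip im : Fin m, ip ∈ A ∧ im ∈ A ∧ ip ≠ im ∧ sg₁ ip = 1 ∧
      sg₁ im = -1 ∧ (A.erase ip).erase im = (A.erase i₁).erase i₂ := by
    rcases hsg i₁ with h1 | h1
    · refine ⟨i₂, i₁, hi₂, hi₁, hne.symm, ?_, ?_, Finset.erase_right_comm⟩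
      · rw [hsg₁ne i₂ hne.symm, ← hss, h1]
      · rw [hsg₁i₁, h1]
    · refine ⟨i₁, i₂, hi₁, hi₂, hne, ?_, ?_, rfl⟩
      · rw [hsg₁i₁, h1]; rfl
      · rw [hsg₁ne i₂ hne.symm, ← hss, h1]
  -- the good step
  obtain ⟨ℓ₂, hbnd₂, hℓ₂c, hKol₂, hidx₂, hreg₂, hsurv₂, hF3₂, hF4₂⟩ :=
    walkStep_good W k hk e hμ hadd₁ hadd₂ hgal halt hnondeg inv hperf hvan hK hD hodd ι hH hρ2 hsurj hτ1
      hcℓ₁ (fun ℓ h ↦ (hprimes₁ ℓ h).1) (fun ℓ h ↦ (hprimes₁ ℓ h).2.1) g₁ sg₁ A hgS₁ hgτ₁ hF3₁ hF4₁ hip him hpm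
      hsp hsm bnd
  rw [hAeq] at hsurv₂ hF3₂ hF4₂
  have hcℓ₂ : Squarefree (c * ℓ₁ * ℓ₂) :=
    Nat.squarefree_mul_iff.mpr ⟨((Nat.Prime.coprime_iff_not_dvd hKol₂.1).mpr hℓ₂c).symm, hcℓ₁, hKol₂.1.squarefree⟩
  have hpf₂ : (c * ℓ₁ * ℓ₂).primeFactors = insert ℓ₂ (c * ℓ₁).primeFactors := by
    rw [Nat.primeFactors_mul hcℓ₁.ne_zero hKol₂.1.ne_zero, hKol₂.1.primeFactors, Finset.union_comm, ← Finset.insert_eq]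
  -- on the remaining alive set the frame is `g` again
  have hA'' : ∀ i ∈ (A.erase i₁).erase i₂, g₁ i = g i := fun i hi ↦
    hg₁ne i (Finset.ne_of_mem_erase (Finset.mem_of_mem_erase hi))
  have hsum : ∀ b : Fin m → ℤ, ∑ i ∈ (A.erase i₁).erase i₂, b i • g₁ i = ∑ i ∈ (A.erase i₁).erase i₂, b i • g i :=
    fun b ↦ Finset.sum_congr rfl fun i hi ↦ by rw [hA'' i hi]
  refine ⟨c * ℓ₁ * ℓ₂, hcℓ₂, ?_, ?_, fun i hi ↦ hA'' i hi ▸ hsurv₂ i hi, fun u hu ↦ ?_, fun b hb ↦ ?_⟩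
  · rw [card_primeFactors_mul_of_not_dvd hcℓ₁.ne_zero hKol₂.1 hℓ₂c, card_primeFactors_mul_of_not_dvd hc0 hKol₁.1 hℓ₁c]
  · intro ℓ h
    rw [hpf₂, Finset.mem_insert] at h
    rcases h with rfl | h
    · exact ⟨hKol₂, hidx₂, hbnd₂, hreg₂⟩
    · exact hprimes₁ ℓ h
  · obtain ⟨b, hb⟩ := hF3₂ u hu
    refine ⟨b, fun ρ hρ ↦ ?_⟩
    have e : J + 2 * d + 1 + 2 * (8 * d + 2 * J + 7) + 2 = 5 * J + 18 * d + 17 := by ring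
    rw [← e, ← hsum]
    exact hb ρ hρ
  · rw [← hsum] at hb
    exact hF4₂ b hb

end Summit.BirchSwinnertonDyer.BirchSwinnertonDyer.Theorems.KolyvaginAtTwo.RegularWalk

end
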